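import Summits.Ventures.YMGap.FlowData.RectTubeMagneticTwistOneSiteLaw
import Summits.Ventures.YMGap.FlowData.RectTubeMagneticTwistSandwich
import HarnessLib

/-!
# Venture YMGap, track Y3 FLOW-DATA — Haar COVARIANCE of two one-site plaquettes sharing a link: `E[X_p X_q] = ½` on `SU(2)`
# (window lemmas on the one-site `k`-torus; theorems only)

HONEST FRAMING: venture file of the cell `pub-ymgap` (QuantumFields programme), track Y3 (FLOW-DATA); companion THEOREMS for
`FlowData/RectTubeOneSitePlaquetteHaar.lean` (`∫∫ Re tr(g h g⁻¹ h⁻¹) = ½`, the Haar MEAN of a one-site plaquette, input of the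
first-order law `RectTubeMagneticTwistOneSiteLaw`).  This file computes the SECOND moments needed by the second-order
strong-coupling law `E_mag = (β/2)(E[M₁] − E[M_S]) + (β²/8)(Var M₁ − Var M_S) + O(β³)` on one-site tori `1^k` (every plaquette is
a commutator `[a_i, a_j]` of two link variables; two plaquettes `(i, j)`, `(i, j′)` share the link `a_i`):

* `su2_integral_re_trace_commutator_eq` — the conditional mean `∫ Re tr(g h g⁻¹ h⁻¹) dh = 2 a₀(g)²` (handle identity at `n = 1`);
* `su2_integral_chebyshevU_one_pow_four` — the fourth moment of the fundamental character `∫ χ₁⁴ = 2` (`χ₁² = χ₀ + χ₂`);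
* **`su2_integral_re_trace_commutator_mul_commutator`** — `∫ (∫ Re tr(g h g⁻¹ h⁻¹) dh)(∫ Re tr(g h′ g⁻¹ h′⁻¹) dh′) dg = ½`:
  two one-site plaquettes sharing a link are POSITIVELY correlated (`E[XY] = ½`, `E[X]E[Y] = ¼`);
* `integral_sub_mean_sq_eq` — `Var M = E[M²] − E[M]²` for the (twisted) magnetic sum of a slice;
* one-site tori `1^k`: `integral_rectSlice_oneSite_three_links_eq` (a function of three distinct links integrates as a triple
  Haar integral), `rectPlaquetteHolonomy_oneSite_eq` (every plaquette is a commutator), and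
  `su2_integral_plaquette_mul_plaquette_oneSite_shared_fst` / `_shared_snd_fst` — `E[X_p X_q] = ½` for two plaquettes sharing a
  link (while `E[X_p] E[X_q] = ¼`): the covariance `¼` that makes the `β²` coefficient of the one-site magnetic-flux energy
  `(k − 2)/4` (assembled in `FlowData/RectTubeMagneticOneSiteSecondOrder.lean`).

Pure Haar-measure identities on `SU(2)` and finite one-site bookkeeping; no FLOW-TABLE number, nothing about `L → ∞` / continuum.

References: I. Montvay, G. Münster (1994) §3.2.6 [cite: MontvayMunster1994, §3.2.6]; G. 't Hooft, Nucl. Phys. B 153 (1979) 141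
[cite: tHooft1979Flux].
-/

noncomputable section

open scoped BigOperators ENNReal
open MeasureTheory Filter Function Polynomial.Chebyshev
open Literature.MathematicalPhysics.QuantumFieldTheory Literature.Analysis.OperatorTheory
open Literature.MathematicalPhysics.QuantumLattice (RectTorusSite fundamentalRep continuous_fundamentalRep
  fundamentalRep_mem_unitaryGroup)
open Summit.Ventures.YMGap.Census (RectPlaquette rectPlaquetteHolonomy)
open Summit.Ventures.LatticeQCDFlow.Exactness Summit.Ventures.LatticeQCDFlow.Scoring

namespace Summit.Ventures.YMGap.FlowData

section Covariance

/-- **Conditional Haar mean of a commutator trace**: `∫ Re tr(g h g⁻¹ h⁻¹) dh = 2 a₀(g)² = ½ (Re tr g)²` on `SU(2)` (the handle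
identity `∫ χ₁(g h g⁻¹ h⁻¹) dh = χ₁(g) χ₁(g⁻¹)/2`). [folklore] -/
theorem su2_integral_re_trace_commutator_eq (g : Matrix.specialUnitaryGroup (Fin 2) ℂ) :
    ∫ h, ((fundamentalRep (Fin 2) (g * h * g⁻¹ * h⁻¹)).trace).re ∂haarProbability (Matrix.specialUnitaryGroup (Fin 2) ℂ) =
      2 * su2a0 g ^ 2 := by
  have hU1 : ∀ x : ℝ, (U ℝ 1).eval x = 2 * x := fun x => by simp [U_one]
  have h := integral_su2Character_handle g g⁻¹ 1
  simp only [Nat.cast_one] at h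
  have hre : ∀ h' : Matrix.specialUnitaryGroup (Fin 2) ℂ, ((fundamentalRep (Fin 2) (g * h' * g⁻¹ * h'⁻¹)).trace).re =
      (U ℝ 1).eval (su2a0 (g * h' * g⁻¹ * h'⁻¹)) := fun h' => by rw [fundamentalRep_trace_re, hU1]
  simp_rw [hre]
  rw [h, su2a0_inv, hU1]
  ring

/-- **The fourth moment of the fundamental character: `∫ χ₁(g)⁴ dg = 2`** (`χ₁² = χ₀ + χ₂` and orthonormality). [folklore] -/
theorem su2_integral_chebyshevU_one_pow_four :
    ∫ g, ((U ℝ 1).eval (su2a0 g)) ^ 4 ∂haarProbability (Matrix.specialUnitaryGroup (Fin 2) ℂ) = 2 := by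
  -- Clebsch–Gordan for polynomials: `U₁² = U₀ + U₂`
  have hcg : ∀ x : ℝ, (U ℝ 1).eval x ^ 2 = (U ℝ 0).eval x + (U ℝ 2).eval x := fun x => by
    simp [U_one, U_two, U_zero]; ring
  have h4 : ∀ x : ℝ, (U ℝ 1).eval x ^ 4 = (U ℝ 0).eval x * (U ℝ 0).eval x + 2 * ((U ℝ 0).eval x * (U ℝ 2).eval x) +
      (U ℝ 2).eval x * (U ℝ 2).eval x := fun x => by
    rw [show (U ℝ 1).eval x ^ 4 = ((U ℝ 1).eval x ^ 2) ^ 2 by ring, hcg]; ring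
  simp_rw [h4]
  have hc : ∀ m n : ℤ, Continuous fun g : Matrix.specialUnitaryGroup (Fin 2) ℂ => (U ℝ m).eval (su2a0 g) * (U ℝ n).eval (su2a0 g) :=
    fun m n => ((U ℝ m).continuous.comp continuous_su2a0).mul ((U ℝ n).continuous.comp continuous_su2a0)
  have hi : ∀ m n : ℤ, Integrable (fun g : Matrix.specialUnitaryGroup (Fin 2) ℂ => (U ℝ m).eval (su2a0 g) * (U ℝ n).eval (su2a0 g))
      (haarProbability (Matrix.specialUnitaryGroup (Fin 2) ℂ)) := fun m n => (hc m n).integrable_of_hasCompactSupport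
        (HasCompactSupport.of_compactSpace _)
  have hi02 : Integrable (fun g : Matrix.specialUnitaryGroup (Fin 2) ℂ => 2 * ((U ℝ 0).eval (su2a0 g) * (U ℝ 2).eval (su2a0 g)))
      (haarProbability (Matrix.specialUnitaryGroup (Fin 2) ℂ)) := (hi 0 2).const_mul 2
  have hi1 : Integrable (fun g : Matrix.specialUnitaryGroup (Fin 2) ℂ => (U ℝ 0).eval (su2a0 g) * (U ℝ 0).eval (su2a0 g) +
      2 * ((U ℝ 0).eval (su2a0 g) * (U ℝ 2).eval (su2a0 g))) (haarProbability (Matrix.specialUnitaryGroup (Fin 2) ℂ)) :=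
    (hi 0 0).add hi02
  have h00 := integral_su2Character_mul_su2Character 0 0
  have h02 := integral_su2Character_mul_su2Character 0 2
  have h22 := integral_su2Character_mul_su2Character 2 2
  simp only [Nat.cast_zero, Nat.cast_ofNat, ↓reduceIte, show (0 : ℕ) ≠ 2 by decide] at h00 h02 h22
  rw [integral_add hi1 (hi 2 2), integral_add (hi 0 0) hi02, integral_const_mul, h00, h02, h22]
  norm_num

/-- **COVARIANCE OF TWO ONE-SITE PLAQUETTES SHARING A LINK**:
`∫ (∫ Re tr(g h g⁻¹ h⁻¹) dh) · (∫ Re tr(g h′ g⁻¹ h′⁻¹) dh′) dg = ½` on `SU(2)`; with `Y = ½ Tr = ½ Re tr` this is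
`E[Y_{(i,j)} · Y_{(i,j′)}] = ⅛ = 2 · E[Y]²` (`E[Y] = ¼`, `RectTubeOneSitePlaquetteHaar`): `Cov = 1/16 > 0`. [folklore] -/
theorem su2_integral_re_trace_commutator_mul_commutator :
    ∫ g, (∫ h, ((fundamentalRep (Fin 2) (g * h * g⁻¹ * h⁻¹)).trace).re ∂haarProbability (Matrix.specialUnitaryGroup (Fin 2) ℂ)) *
        (∫ h', ((fundamentalRep (Fin 2) (g * h' * g⁻¹ * h'⁻¹)).trace).re ∂haarProbability (Matrix.specialUnitaryGroup (Fin 2) ℂ))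
      ∂haarProbability (Matrix.specialUnitaryGroup (Fin 2) ℂ) = 1 / 2 := by
  simp_rw [su2_integral_re_trace_commutator_eq]
  have hU1 : ∀ x : ℝ, (U ℝ 1).eval x = 2 * x := fun x => by simp [U_one]
  have h : ∀ g : Matrix.specialUnitaryGroup (Fin 2) ℂ, 2 * su2a0 g ^ 2 * (2 * su2a0 g ^ 2) =
      (1 / 4 : ℝ) * ((U ℝ 1).eval (su2a0 g)) ^ 4 := fun g => by rw [hU1]; ring
  simp_rw [h]
  rw [integral_const_mul, su2_integral_chebyshevU_one_pow_four]
  norm_num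

/-- The same as a TRIPLE integral `∫∫∫ Re tr(g h g⁻¹ h⁻¹) · Re tr(g h′ g⁻¹ h′⁻¹) dh′ dh dg = ½`. [folklore] -/
theorem su2_integral_re_trace_commutator_mul_commutator' :
    ∫ g, ∫ h, ∫ h', ((fundamentalRep (Fin 2) (g * h * g⁻¹ * h⁻¹)).trace).re *
        ((fundamentalRep (Fin 2) (g * h' * g⁻¹ * h'⁻¹)).trace).re ∂haarProbability (Matrix.specialUnitaryGroup (Fin 2) ℂ)
        ∂haarProbability (Matrix.specialUnitaryGroup (Fin 2) ℂ) ∂haarProbability (Matrix.specialUnitaryGroup (Fin 2) ℂ) = 1 / 2 := by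
  have hinner : ∀ g h : Matrix.specialUnitaryGroup (Fin 2) ℂ,
      ∫ h', ((fundamentalRep (Fin 2) (g * h * g⁻¹ * h⁻¹)).trace).re * ((fundamentalRep (Fin 2) (g * h' * g⁻¹ * h'⁻¹)).trace).re
          ∂haarProbability (Matrix.specialUnitaryGroup (Fin 2) ℂ) =
        ((fundamentalRep (Fin 2) (g * h * g⁻¹ * h⁻¹)).trace).re * (2 * su2a0 g ^ 2) := fun g h => by
    rw [integral_const_mul, su2_integral_re_trace_commutator_eq]
  simp_rw [hinner]
  have hmid : ∀ g : Matrix.specialUnitaryGroup (Fin 2) ℂ,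
      ∫ h, ((fundamentalRep (Fin 2) (g * h * g⁻¹ * h⁻¹)).trace).re * (2 * su2a0 g ^ 2)
          ∂haarProbability (Matrix.specialUnitaryGroup (Fin 2) ℂ) = (2 * su2a0 g ^ 2) * (2 * su2a0 g ^ 2) := fun g => by
    rw [integral_mul_const, su2_integral_re_trace_commutator_eq]
  simp_rw [hmid]
  have h := su2_integral_re_trace_commutator_mul_commutator
  simp_rw [su2_integral_re_trace_commutator_eq] at h
  exact h

end Covariance

/-! ### The variance of the (twisted) magnetic sum of a slice -/

section Variance

variable {G : Type*} [Group G] [TopologicalSpace G] [IsTopologicalGroup G] [CompactSpace G]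
  [MeasurableSpace G] [BorelSpace G] [SecondCountableTopology G] {n k : ℕ} (ρ : G →* Matrix (Fin n) (Fin n) ℂ)
  {Ls : Fin k → ℕ} [∀ i, NeZero (Ls i)]

/-- `∫ (M − ∫M)² = ∫ M² − (∫M)²` for a continuous function on the slice (probability measure). [folklore] -/
theorem integral_sub_mean_sq_eq (hρ : Continuous ρ) (ζ : RectPlaquette Ls → G) :
    ∫ a, (rectMagSumTw ρ ζ a - ∫ b, rectMagSumTw ρ ζ b ∂(rectSliceMeasure G Ls)) ^ 2 ∂(rectSliceMeasure G Ls) =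
      (∫ a, rectMagSumTw ρ ζ a ^ 2 ∂(rectSliceMeasure G Ls)) - (∫ b, rectMagSumTw ρ ζ b ∂(rectSliceMeasure G Ls)) ^ 2 := by
  set μ : Measure (RectSlice Ls G) := rectSliceMeasure G Ls with hμ
  set M : RectSlice Ls G → ℝ := rectMagSumTw ρ ζ with hM
  set m : ℝ := ∫ b, M b ∂μ with hm
  have hc : Continuous M := continuous_rectMagSumTw ρ (Ls := Ls) hρ ζ
  have cintS : ∀ {f : RectSlice Ls G → ℝ}, Continuous f → Integrable f μ :=
    fun hf => hf.integrable_of_hasCompactSupport (HasCompactSupport.of_compactSpace _)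
  have hexp : ∀ a, (M a - m) ^ 2 = M a ^ 2 - 2 * m * M a + m ^ 2 := fun a => by ring
  simp_rw [hexp]
  have i1 : Integrable (fun a => M a ^ 2) μ := cintS (hc.pow 2)
  have i2 : Integrable (fun a => 2 * m * M a) μ := (cintS hc).const_mul _
  have i12 : Integrable (fun a => M a ^ 2 - 2 * m * M a) μ := i1.sub i2
  rw [integral_add i12 (integrable_const _), integral_sub i1 i2, integral_const_mul, integral_const, probReal_univ,
    one_smul, ← hm]
  ring

end Variance

/-! ### One-site tori -/

section OneSiteWindow

/-- **A function of three distinct links `i, j, l` of the one-site `k`-torus integrates as a triple Haar integral** (the other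
links integrate out; probability Haar measure). [folklore] -/
theorem integral_rectSlice_oneSite_three_links_eq {k : ℕ} (x : RectTorusSite (fun _ : Fin k => 1)) {i j l : Fin k} (hij : i ≠ j)
    (hil : i ≠ l)
    (hjl : j ≠ l) {F : (Matrix.specialUnitaryGroup (Fin 2) ℂ) → (Matrix.specialUnitaryGroup (Fin 2) ℂ) → (Matrix.specialUnitaryGroup (Fin 2) ℂ) → ℝ} (hF : Continuous fun z : (Matrix.specialUnitaryGroup (Fin 2) ℂ) × (Matrix.specialUnitaryGroup (Fin 2) ℂ) × (Matrix.specialUnitaryGroup (Fin 2) ℂ) => F z.1 z.2.1 z.2.2) :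
    ∫ a, F (a (x, i)) (a (x, j)) (a (x, l)) ∂(rectSliceMeasure (Matrix.specialUnitaryGroup (Fin 2) ℂ) (fun _ : Fin k => 1)) =
      ∫ g, ∫ h, ∫ h', F g h h' ∂haarProbability (Matrix.specialUnitaryGroup (Fin 2) ℂ) ∂haarProbability (Matrix.specialUnitaryGroup (Fin 2) ℂ) ∂haarProbability (Matrix.specialUnitaryGroup (Fin 2) ℂ) := by
  classical
  haveI : SecondCountableTopology (Matrix.specialUnitaryGroup (Fin 2) ℂ) := Literature.MathematicalPhysics.QuantumLattice.secondCountableTopology_su2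
  -- the three links as an injective window
  set ℓ : Fin 3 → RectTorusSite (fun _ : Fin k => 1) × Fin k := ![(x, i), (x, j), (x, l)] with hℓ
  have hℓinj : Injective ℓ := by
    intro s t hst
    have h2 := congrArg Prod.snd hst
    fin_cases s <;> fin_cases t <;> simp_all
  set s : Set (RectTorusSite (fun _ : Fin k => 1) × Fin k) := Set.range ℓ with hs
  set e : Fin 3 ⊕ ↥sᶜ ≃ RectTorusSite (fun _ : Fin k => 1) × Fin k :=
    (Equiv.sumCongr (Equiv.ofInjective ℓ hℓinj) (Equiv.refl _)).trans (Equiv.Set.sumCompl s) with he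
  have he1 : ∀ t : Fin 3, e (Sum.inl t) = ℓ t := fun t => by simp [he, Equiv.Set.sumCompl_apply_inl]
  set f : (Fin 3 → (Matrix.specialUnitaryGroup (Fin 2) ℂ)) → ℝ := fun y => F (y 0) (y 1) (y 2) with hf
  have h1 : (fun a : RectSlice (fun _ : Fin k => 1) (Matrix.specialUnitaryGroup (Fin 2) ℂ) => F (a (x, i)) (a (x, j)) (a (x, l))) =
      fun a => f (fun t => a (e (Sum.inl t))) *
        ∏ t : RectTorusSite (fun _ : Fin k => 1) × Fin k, (fun _ : RectTorusSite (fun _ : Fin k => 1) × Fin k =>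
          fun _ : (Matrix.specialUnitaryGroup (Fin 2) ℂ) => (1 : ℝ)) t (a t) := by
    funext a
    rw [Finset.prod_const_one, mul_one, hf]
    simp only [he1, hℓ, Matrix.cons_val_zero, Matrix.cons_val_one, Matrix.cons_val_two, Matrix.tail_cons,
      Matrix.head_cons]
  rw [h1, slab_integral_pi_window_one (haarProbability (Matrix.specialUnitaryGroup (Fin 2) ℂ)) e (fun _ => fun _ : (Matrix.specialUnitaryGroup (Fin 2) ℂ) => (1 : ℝ)) f]
  simp only [Finset.prod_const_one, mul_one, integral_const, smul_eq_mul, probReal_univ]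
  -- the window integral over `Fin 3 → SU(2)` as an iterated integral
  have hfc : Continuous f := by
    have h3 : Continuous fun y : Fin 3 → (Matrix.specialUnitaryGroup (Fin 2) ℂ) => ((y 0, (y 1, y 2)) : (Matrix.specialUnitaryGroup (Fin 2) ℂ) × (Matrix.specialUnitaryGroup (Fin 2) ℂ) × (Matrix.specialUnitaryGroup (Fin 2) ℂ)) :=
      (continuous_apply 0).prodMk ((continuous_apply 1).prodMk (continuous_apply 2))
    exact hF.comp h3
  have hmp := measurePreserving_piFinSuccAbove (fun _ : Fin 3 => haarProbability (Matrix.specialUnitaryGroup (Fin 2) ℂ)) 0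
  rw [← hmp.symm.integral_comp' (g := f)]
  have hg : ∀ z : (Matrix.specialUnitaryGroup (Fin 2) ℂ) × (Fin 2 → (Matrix.specialUnitaryGroup (Fin 2) ℂ)),
      f ((MeasurableEquiv.piFinSuccAbove (fun _ : Fin 3 => (Matrix.specialUnitaryGroup (Fin 2) ℂ)) 0).symm z) = F z.1 (z.2 0) (z.2 1) := by
    intro z
    simp only [hf, MeasurableEquiv.piFinSuccAbove_symm_apply, Fin.insertNthEquiv, Fin.insertNth_zero']
    rfl
  simp_rw [hg]
  have hc2 : Continuous fun z : (Matrix.specialUnitaryGroup (Fin 2) ℂ) × (Fin 2 → (Matrix.specialUnitaryGroup (Fin 2) ℂ)) => F z.1 (z.2 0) (z.2 1) := by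
    have h3 : Continuous fun z : (Matrix.specialUnitaryGroup (Fin 2) ℂ) × (Fin 2 → (Matrix.specialUnitaryGroup (Fin 2) ℂ)) => ((z.1, (z.2 0, z.2 1)) : (Matrix.specialUnitaryGroup (Fin 2) ℂ) × (Matrix.specialUnitaryGroup (Fin 2) ℂ) × (Matrix.specialUnitaryGroup (Fin 2) ℂ)) :=
      continuous_fst.prodMk (((continuous_apply 0).comp continuous_snd).prodMk ((continuous_apply 1).comp continuous_snd))
    exact hF.comp h3
  rw [integral_prod _ (hc2.integrable_of_hasCompactSupport (HasCompactSupport.of_compactSpace _))]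
  refine integral_congr_ae (ae_of_all _ fun g => ?_)
  beta_reduce
  -- the inner integral over `Fin 2 → SU(2)`
  have hmp2 := measurePreserving_finTwoArrow (haarProbability (Matrix.specialUnitaryGroup (Fin 2) ℂ))
  rw [← hmp2.symm.integral_comp' (g := fun z : Fin 2 → (Matrix.specialUnitaryGroup (Fin 2) ℂ) => F g (z 0) (z 1))]
  have hg2 : ∀ w : (Matrix.specialUnitaryGroup (Fin 2) ℂ) × (Matrix.specialUnitaryGroup (Fin 2) ℂ), (fun z : Fin 2 → (Matrix.specialUnitaryGroup (Fin 2) ℂ) => F g (z 0) (z 1)) ((MeasurableEquiv.finTwoArrow).symm w) = F g w.1 w.2 := by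
    intro w
    simp only [MeasurableEquiv.finTwoArrow_symm_apply, Fin.cons_zero, Fin.cons_one]
  simp_rw [hg2]
  have hc3 : Continuous fun w : (Matrix.specialUnitaryGroup (Fin 2) ℂ) × (Matrix.specialUnitaryGroup (Fin 2) ℂ) => F g w.1 w.2 := by
    have h3 : Continuous fun w : (Matrix.specialUnitaryGroup (Fin 2) ℂ) × (Matrix.specialUnitaryGroup (Fin 2) ℂ) => ((g, (w.1, w.2)) : (Matrix.specialUnitaryGroup (Fin 2) ℂ) × (Matrix.specialUnitaryGroup (Fin 2) ℂ) × (Matrix.specialUnitaryGroup (Fin 2) ℂ)) :=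
      continuous_const.prodMk (continuous_fst.prodMk continuous_snd)
    exact hF.comp h3
  rw [integral_prod _ (hc3.integrable_of_hasCompactSupport (HasCompactSupport.of_compactSpace _))]

/-- On the one-site torus every plaquette holonomy is the commutator of its two links. [folklore] -/
theorem rectPlaquetteHolonomy_oneSite_eq {k : ℕ} (a : RectSlice (fun _ : Fin k => 1) (Matrix.specialUnitaryGroup (Fin 2) ℂ))
    (x : RectTorusSite (fun _ : Fin k => 1)) (i j : Fin k) :
    rectPlaquetteHolonomy a x i j = a (x, i) * a (x, j) * (a (x, i))⁻¹ * (a (x, j))⁻¹ :=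
  rectPlaquetteHolonomy_of_single_eq_zero a x (rectTorusSite_oneSite_single_eq_zero i)
    (rectTorusSite_oneSite_single_eq_zero j)

/-- The trace of a commutator is symmetric in its two arguments (`SU(2)`): `Re tr[g,h] = Re tr[h,g]`. [folklore] -/
theorem su2_re_trace_commutator_comm (g h : (Matrix.specialUnitaryGroup (Fin 2) ℂ)) :
    ((fundamentalRep (Fin 2) (g * h * g⁻¹ * h⁻¹)).trace).re = ((fundamentalRep (Fin 2) (h * g * h⁻¹ * g⁻¹)).trace).re := by
  have hinv : (h * g * h⁻¹ * g⁻¹)⁻¹ = g * h * g⁻¹ * h⁻¹ := by group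
  rw [← hinv, fundamentalRep_trace_re, fundamentalRep_trace_re, su2a0_inv]

/-- **`E[X_{(i,j)}·X_{(i,l)}] = ½`** for two plaquettes of the one-site `k`-torus sharing their FIRST link `i` (`j ≠ l`).
[cite: MontvayMunster1994, §3.2.6] -/
theorem su2_integral_plaquette_mul_plaquette_oneSite_shared_fst {k : ℕ} (x : RectTorusSite (fun _ : Fin k => 1)) {i j l : Fin k}
    (hij : i ≠ j) (hil : i ≠ l) (hjl : j ≠ l) :
    ∫ a, ((fundamentalRep (Fin 2) (rectPlaquetteHolonomy a x i j)).trace).re *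
        ((fundamentalRep (Fin 2) (rectPlaquetteHolonomy a x i l)).trace).re ∂(rectSliceMeasure (Matrix.specialUnitaryGroup (Fin 2) ℂ) (fun _ : Fin k => 1)) = 1 / 2 := by
  simp_rw [rectPlaquetteHolonomy_oneSite_eq]
  have hc : Continuous fun z : (Matrix.specialUnitaryGroup (Fin 2) ℂ) × (Matrix.specialUnitaryGroup (Fin 2) ℂ) × (Matrix.specialUnitaryGroup (Fin 2) ℂ) =>
      ((fundamentalRep (Fin 2) (z.1 * z.2.1 * z.1⁻¹ * z.2.1⁻¹)).trace).re *
        ((fundamentalRep (Fin 2) (z.1 * z.2.2 * z.1⁻¹ * z.2.2⁻¹)).trace).re := by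
    have htr : Continuous fun g : (Matrix.specialUnitaryGroup (Fin 2) ℂ) => ((fundamentalRep (Fin 2) g).trace).re :=
      Complex.continuous_re.comp (Continuous.matrix_trace (continuous_fundamentalRep (Fin 2)))
    have h1 : Continuous fun z : (Matrix.specialUnitaryGroup (Fin 2) ℂ) × (Matrix.specialUnitaryGroup (Fin 2) ℂ) × (Matrix.specialUnitaryGroup (Fin 2) ℂ) => z.1 := continuous_fst
    have h2 : Continuous fun z : (Matrix.specialUnitaryGroup (Fin 2) ℂ) × (Matrix.specialUnitaryGroup (Fin 2) ℂ) × (Matrix.specialUnitaryGroup (Fin 2) ℂ) => z.2.1 := continuous_fst.comp continuous_snd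
    have h3 : Continuous fun z : (Matrix.specialUnitaryGroup (Fin 2) ℂ) × (Matrix.specialUnitaryGroup (Fin 2) ℂ) × (Matrix.specialUnitaryGroup (Fin 2) ℂ) => z.2.2 := continuous_snd.comp continuous_snd
    exact (htr.comp (((h1.mul h2).mul h1.inv).mul h2.inv)).mul (htr.comp (((h1.mul h3).mul h1.inv).mul h3.inv))
  rw [integral_rectSlice_oneSite_three_links_eq x hij hil hjl (F := fun g h h' =>
    ((fundamentalRep (Fin 2) (g * h * g⁻¹ * h⁻¹)).trace).re * ((fundamentalRep (Fin 2) (g * h' * g⁻¹ * h'⁻¹)).trace).re) hc]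
  exact su2_integral_re_trace_commutator_mul_commutator'

/-- **`E[X_{(i,j)}·X_{(j,l)}] = ½`** for two plaquettes of the one-site `k`-torus sharing the link `j` (second link of the first,
first link of the second; `i ≠ l`). [cite: MontvayMunster1994, §3.2.6] -/
theorem su2_integral_plaquette_mul_plaquette_oneSite_shared_snd_fst {k : ℕ} (x : RectTorusSite (fun _ : Fin k => 1)) {i j l : Fin k}
    (hij : i ≠ j) (hil : i ≠ l) (hjl : j ≠ l) :
    ∫ a, ((fundamentalRep (Fin 2) (rectPlaquetteHolonomy a x i j)).trace).re *
        ((fundamentalRep (Fin 2) (rectPlaquetteHolonomy a x j l)).trace).re ∂(rectSliceMeasure (Matrix.specialUnitaryGroup (Fin 2) ℂ) (fun _ : Fin k => 1)) = 1 / 2 := by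
  simp_rw [rectPlaquetteHolonomy_oneSite_eq]
  -- `Re tr[a_i,a_j] = Re tr[a_j,a_i]`: both factors are commutators with the SHARED link `a_j` in front
  have hpt : ∀ a : RectSlice (fun _ : Fin k => 1) (Matrix.specialUnitaryGroup (Fin 2) ℂ),
      ((fundamentalRep (Fin 2) (a (x, i) * a (x, j) * (a (x, i))⁻¹ * (a (x, j))⁻¹)).trace).re *
          ((fundamentalRep (Fin 2) (a (x, j) * a (x, l) * (a (x, j))⁻¹ * (a (x, l))⁻¹)).trace).re =
        (fun g h h' : (Matrix.specialUnitaryGroup (Fin 2) ℂ) => ((fundamentalRep (Fin 2) (g * h * g⁻¹ * h⁻¹)).trace).re *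
          ((fundamentalRep (Fin 2) (g * h' * g⁻¹ * h'⁻¹)).trace).re) (a (x, j)) (a (x, i)) (a (x, l)) := fun a => by
    beta_reduce
    rw [su2_re_trace_commutator_comm (a (x, i)) (a (x, j))]
  rw [show (fun a : RectSlice (fun _ : Fin k => 1) (Matrix.specialUnitaryGroup (Fin 2) ℂ) =>
      ((fundamentalRep (Fin 2) (a (x, i) * a (x, j) * (a (x, i))⁻¹ * (a (x, j))⁻¹)).trace).re *
        ((fundamentalRep (Fin 2) (a (x, j) * a (x, l) * (a (x, j))⁻¹ * (a (x, l))⁻¹)).trace).re) =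
      fun a => (fun g h h' : (Matrix.specialUnitaryGroup (Fin 2) ℂ) =>
        ((fundamentalRep (Fin 2) (g * h * g⁻¹ * h⁻¹)).trace).re *
          ((fundamentalRep (Fin 2) (g * h' * g⁻¹ * h'⁻¹)).trace).re) (a (x, j)) (a (x, i)) (a (x, l)) from funext hpt]
  have hc : Continuous fun z : (Matrix.specialUnitaryGroup (Fin 2) ℂ) × (Matrix.specialUnitaryGroup (Fin 2) ℂ) × (Matrix.specialUnitaryGroup (Fin 2) ℂ) =>
      ((fundamentalRep (Fin 2) (z.1 * z.2.1 * z.1⁻¹ * z.2.1⁻¹)).trace).re *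
        ((fundamentalRep (Fin 2) (z.1 * z.2.2 * z.1⁻¹ * z.2.2⁻¹)).trace).re := by
    have htr : Continuous fun g : (Matrix.specialUnitaryGroup (Fin 2) ℂ) => ((fundamentalRep (Fin 2) g).trace).re :=
      Complex.continuous_re.comp (Continuous.matrix_trace (continuous_fundamentalRep (Fin 2)))
    have h1 : Continuous fun z : (Matrix.specialUnitaryGroup (Fin 2) ℂ) × (Matrix.specialUnitaryGroup (Fin 2) ℂ) × (Matrix.specialUnitaryGroup (Fin 2) ℂ) => z.1 := continuous_fst
    have h2 : Continuous fun z : (Matrix.specialUnitaryGroup (Fin 2) ℂ) × (Matrix.specialUnitaryGroup (Fin 2) ℂ) × (Matrix.specialUnitaryGroup (Fin 2) ℂ) => z.2.1 := continuous_fst.comp continuous_snd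
    have h3 : Continuous fun z : (Matrix.specialUnitaryGroup (Fin 2) ℂ) × (Matrix.specialUnitaryGroup (Fin 2) ℂ) × (Matrix.specialUnitaryGroup (Fin 2) ℂ) => z.2.2 := continuous_snd.comp continuous_snd
    exact (htr.comp (((h1.mul h2).mul h1.inv).mul h2.inv)).mul (htr.comp (((h1.mul h3).mul h1.inv).mul h3.inv))
  rw [integral_rectSlice_oneSite_three_links_eq x hij.symm hjl hil
    (F := fun g h h' : (Matrix.specialUnitaryGroup (Fin 2) ℂ) =>
      ((fundamentalRep (Fin 2) (g * h * g⁻¹ * h⁻¹)).trace).re * ((fundamentalRep (Fin 2) (g * h' * g⁻¹ * h'⁻¹)).trace).re) hc]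
  exact su2_integral_re_trace_commutator_mul_commutator'

end OneSiteWindow

end Summit.Ventures.YMGap.FlowData
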